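import Summits.NavierStokesRegularity.NavierStokesRegularity.Theorems.RellichScarSymmetricScarExistsRdssRobustSlowScrew
import Summits.NavierStokesRegularity.NavierStokesRegularity.Theorems.SqueezeCycleRecurrentLiouvilleRotationalAbsorptionFast

/-!
# Crux `SymmetricScarExists` (stmt-NavierStokesRegularity-11718), line `rdss-screw-split` — stub
# `stub_rotInvariantLimit` (AUX-3): screw invariance with factors `c_j → 1` becomes rotation invariance
# of the `L³_loc` limit

Helper file of the line lead (`--supports stmt-NavierStokesRegularity-11718`; theorems only, no definitions,
no named facts), pure real analysis.  Let `V_j → u` in `L³(Q(0,R))` for every `R > 0`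
(`Q(0,R) = ]-R², 0[ × B(0,R)` = `parabolicCylinder R 0`), let every `V_j` be a.e. fixed on the slab
`(-∞, 0) × ℝ³` by the screw `w ↦ R_θ D_{c_j} w ∘ R_{−θ}` (`(D_c w)(t, x) = c w(c² t, c x)` = `nsRescale c w`,
`R_θ = rotZ θ` the rotation about `e₃`), with `c_j > 0`, `c_j → 1`, and let the dilations `D_{c_j} u → u`
in every `L³(Q(0,R))` (AUX-2).  Then `R_θ u(t, R_{−θ} x) = u(t, x)` a.e. on the slab (`stub_rotInvariantLimit`).

Proof (`rotInvariantLimit_ae_ball`).  On each ball `Q(0,R)`, for `j` so large that `e^{-1} ≤ c_j ≤ e`,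
`‖R_θ u∘R_{−θ} − u‖ ≤ ‖R_θ u∘R_{−θ} − R_θ D_{c_j}u∘R_{−θ}‖ + ‖R_θ D_{c_j}u∘R_{−θ} − V_j‖ + ‖V_j − u‖`; the first
term is `‖u − D_{c_j}u‖_{L³(Q(0,R))}` (the rotated conjugation is an isometry of `L³(Q(0,R))`,
`rlRotAbs_eLpNorm_conj`), the second is `‖R_θ D_{c_j}u∘R_{−θ} − R_θ D_{c_j}V_j∘R_{−θ}‖ = c_j (c_j⁵)^{-1/3}
‖u − V_j‖_{L³(Q(0,c_j R))}` (a.e. `V_j = R_θ D_{c_j}V_j∘R_{−θ}` on the ball, then the exact scaling law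
`Robust.eLpNorm_screw_sub_screw`; the constant is bounded on `[e^{-1}, e]`, `rlRotAbs_zoomConst_le`, and
`Q(0, c_j R) ⊆ Q(0, eR)`), so all three terms tend to `0`; finally the balls `Q(0, n+1)` exhaust the slab.

## References

* D. Chae, J. Wolf, arXiv:1610.09464 (2017), Thm 1.3 (the same passage to the limit in a screw defect).
  [ChaeWolf2017RemovingDSS]
* W. Rudin, *Real and Complex Analysis*, 3rd ed., Thm. 3.12 (vanishing `L^p` norm ⇒ a.e. zero). [folklore]
-/

noncomputable section

open MeasureTheory Set Function Filter Topology TopologicalSpace Metric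
open scoped NNReal ENNReal

namespace Summit.NavierStokesRegularity.NavierStokesRegularity.Theorems.SymmetricScarExists.RdssSplit.NearIdentity

set_option linter.dupNamespace false

open Literature.Analysis.FluidPDE

/-- **The rotation defect of an `L³_loc` limit of `(c_j, θ)`-screw-invariant fields vanishes on every ball**
when `c_j → 1` and the dilations `D_{c_j} u → u` in `L³(Q(0,R))`: three-term splitting
`‖R_θ u∘R_{−θ} − u‖ ≤ ‖u − D_{c_j}u‖ + c_j(c_j⁵)^{-1/3} ‖u − V_j‖_{Q(0,c_jR)} + ‖V_j − u‖` on the tail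
`e^{-1} ≤ c_j ≤ e`, every term tending to `0`. [folklore] -/
theorem rotInvariantLimit_ae_ball (θ : ℝ) {c : ℕ → ℝ}
    {V : ℕ → ℝ → EuclideanSpace ℝ (Fin 3) → EuclideanSpace ℝ (Fin 3)}
    {u : ℝ → EuclideanSpace ℝ (Fin 3) → EuclideanSpace ℝ (Fin 3)}
    (hc0 : ∀ j, 0 < c j) (hc1 : Tendsto c atTop (𝓝 1))
    (hVm : ∀ (j : ℕ) (r : ℝ), 0 < r → ∀ R : ℝ, 0 < R → AEStronglyMeasurable (uncurry (nsRescale r (V j)))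
      (volume.restrict (parabolicCylinder R (0 : ℝ × EuclideanSpace ℝ (Fin 3)))))
    (hum : ∀ (r : ℝ), 0 < r → ∀ R : ℝ, 0 < R → AEStronglyMeasurable (uncurry (nsRescale r u))
      (volume.restrict (parabolicCylinder R (0 : ℝ × EuclideanSpace ℝ (Fin 3)))))
    (hconv : ∀ R : ℝ, 0 < R → Tendsto (fun j => eLpNorm (uncurry (V j) - uncurry u) 3
      (volume.restrict (parabolicCylinder R (0 : ℝ × EuclideanSpace ℝ (Fin 3))))) atTop (𝓝 0))
    (hdil : ∀ R : ℝ, 0 < R → Tendsto (fun j => eLpNorm (uncurry (nsRescale (c j) u) - uncurry u) 3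
      (volume.restrict (parabolicCylinder R (0 : ℝ × EuclideanSpace ℝ (Fin 3))))) atTop (𝓝 0))
    (hfix : ∀ j, uncurry (fun t x => rotZ θ (nsRescale (c j) (V j) t (rotZ (-θ) x)))
      =ᵐ[volume.restrict (Iio (0 : ℝ) ×ˢ (univ : Set (EuclideanSpace ℝ (Fin 3))))] uncurry (V j))
    {R : ℝ} (hR : 0 < R) :
    ∀ᵐ z ∂(volume.restrict (parabolicCylinder R (0 : ℝ × EuclideanSpace ℝ (Fin 3)))),
      uncurry (fun t x => rotZ θ (u t (rotZ (-θ) x))) z = uncurry u z := by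
  have h13 : (1 : ℝ≥0∞) ≤ 3 := by norm_num
  -- unscaled measurability
  have hum1 : ∀ R : ℝ, 0 < R → AEStronglyMeasurable (uncurry u)
      (volume.restrict (parabolicCylinder R (0 : ℝ × EuclideanSpace ℝ (Fin 3)))) := by
    intro R hR
    have h := hum 1 one_pos R hR
    rwa [nsRescale_one] at h
  have hVm1 : ∀ (j : ℕ) (R : ℝ), 0 < R → AEStronglyMeasurable (uncurry (V j))
      (volume.restrict (parabolicCylinder R (0 : ℝ × EuclideanSpace ℝ (Fin 3)))) := by
    intro j R hR
    have h := hVm j 1 one_pos R hR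
    rwa [nsRescale_one] at h
  set μR : Measure (ℝ × EuclideanSpace ℝ (Fin 3)) :=
    volume.restrict (parabolicCylinder R (0 : ℝ × EuclideanSpace ℝ (Fin 3))) with hμR
  set Su : ℝ × EuclideanSpace ℝ (Fin 3) → EuclideanSpace ℝ (Fin 3) :=
    uncurry (fun t x => rotZ θ (u t (rotZ (-θ) x)))
  set SDu : ℕ → ℝ × EuclideanSpace ℝ (Fin 3) → EuclideanSpace ℝ (Fin 3) :=
    fun j => uncurry (fun t x => rotZ θ (nsRescale (c j) u t (rotZ (-θ) x))) with hSDu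
  set SV : ℕ → ℝ × EuclideanSpace ℝ (Fin 3) → EuclideanSpace ℝ (Fin 3) :=
    fun j => uncurry (fun t x => rotZ θ (nsRescale (c j) (V j) t (rotZ (-θ) x))) with hSV
  have hSum : AEStronglyMeasurable Su μR :=
    rlRotAbs_aesm_conj θ R (g := uncurry u) (hum1 R hR)
  have hSDum : ∀ j, AEStronglyMeasurable (SDu j) μR := fun j =>
    rlRotAbs_aesm_conj θ R (g := uncurry (nsRescale (c j) u)) (hum (c j) (hc0 j) R hR)
  have hUm : AEStronglyMeasurable (uncurry u) μR := hum1 R hR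
  have hVjm : ∀ j, AEStronglyMeasurable (uncurry (V j)) μR := fun j => hVm1 j R hR
  -- the screw invariance of `V_j`, restricted to the ball
  have hfixR : ∀ j, SV j =ᵐ[μR] uncurry (V j) := fun j =>
    ae_restrict_of_ae_restrict_of_subset (parabolicCylinder_origin_subset_slab R) (hfix j)
  -- the bound on the scaling constants on the tail `e^{-1} ≤ c_j ≤ e`
  set K : ℝ≥0∞ := ENNReal.ofReal (Real.exp 1) *
    (ENNReal.ofReal (Real.exp (-1) ^ 2 * Real.exp (-1) ^ 3)⁻¹) ^ (1 / (3 : ℝ≥0∞).toReal)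
  have hKtop : K ≠ ⊤ := ENNReal.mul_ne_top ENNReal.ofReal_ne_top
    (ENNReal.rpow_ne_top_of_nonneg (by norm_num) ENNReal.ofReal_ne_top)
  have heR : (0 : ℝ) < Real.exp 1 * R := by positivity
  have htail : ∀ᶠ j in atTop, Real.exp (-1) ≤ c j ∧ c j ≤ Real.exp 1 :=
    hc1.eventually_mem (Icc_mem_nhds (Real.exp_lt_one_iff.2 (by norm_num))
      (Real.one_lt_exp_iff.2 one_pos))
  -- the three-term bound on the tail
  have hev : ∀ᶠ j in atTop, eLpNorm (Su - uncurry u) 3 μR ≤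
      eLpNorm (uncurry (nsRescale (c j) u) - uncurry u) 3 μR +
        (K * eLpNorm (uncurry (V j) - uncurry u) 3
            (volume.restrict (parabolicCylinder (Real.exp 1 * R) (0 : ℝ × EuclideanSpace ℝ (Fin 3)))) +
          eLpNorm (uncurry (V j) - uncurry u) 3 μR) := by
    filter_upwards [htail] with j hj
    have e : Su - uncurry u = (Su - SDu j) + ((SDu j - uncurry (V j)) + (uncurry (V j) - uncurry u)) := by
      rw [sub_add_sub_cancel, sub_add_sub_cancel]
    -- first term: the rotated conjugation is an isometry of `L³(Q(0,R))`
    have hA : eLpNorm (Su - SDu j) 3 μR = eLpNorm (uncurry (nsRescale (c j) u) - uncurry u) 3 μR := by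
      have e1 : Su - SDu j = fun z : ℝ × EuclideanSpace ℝ (Fin 3) =>
          rotZ θ (uncurry u (z.1, rotZ (-θ) z.2)) -
            rotZ θ (uncurry (nsRescale (c j) u) (z.1, rotZ (-θ) z.2)) := rfl
      rw [e1, hμR, rlRotAbs_eLpNorm_conj θ R (hum1 R hR) (hum (c j) (hc0 j) R hR), eLpNorm_sub_comm]
    -- second term: a.e. `V_j` is its own screw image, then the exact scaling law
    have hB : eLpNorm (SDu j - uncurry (V j)) 3 μR ≤
        K * eLpNorm (uncurry (V j) - uncurry u) 3
          (volume.restrict (parabolicCylinder (Real.exp 1 * R) (0 : ℝ × EuclideanSpace ℝ (Fin 3)))) := by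
      have e2 : eLpNorm (SDu j - uncurry (V j)) 3 μR = eLpNorm (SDu j - SV j) 3 μR := by
        refine eLpNorm_congr_ae ?_
        filter_upwards [hfixR j] with z hz
        rw [Pi.sub_apply, Pi.sub_apply, hz]
      rw [e2, hSDu, hSV, hμR, Robust.eLpNorm_screw_sub_screw (hc0 j) θ R (hum (c j) (hc0 j) R hR)
        (hVm j (c j) (hc0 j) R hR), eLpNorm_sub_comm]
      refine mul_le_mul' (rlRotAbs_zoomConst_le hj.1 hj.2) ?_
      exact eLpNorm_mono_measure _ (Measure.restrict_mono
        (SuitableCompactness.parabolicCylinder_zero_mono (mul_nonneg (hc0 j).le hR.le)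
          (mul_le_mul_of_nonneg_right hj.2 hR.le)) le_rfl)
    calc eLpNorm (Su - uncurry u) 3 μR
        ≤ eLpNorm (Su - SDu j) 3 μR +
            eLpNorm ((SDu j - uncurry (V j)) + (uncurry (V j) - uncurry u)) 3 μR := by
          rw [e]
          exact eLpNorm_add_le (hSum.sub (hSDum j)) (((hSDum j).sub (hVjm j)).add ((hVjm j).sub hUm)) h13
      _ ≤ _ := by
          rw [hA]
          exact add_le_add le_rfl ((eLpNorm_add_le ((hSDum j).sub (hVjm j)) ((hVjm j).sub hUm) h13).trans
            (add_le_add hB le_rfl))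
  -- the three terms tend to zero
  have hBlim : Tendsto (fun j => K * eLpNorm (uncurry (V j) - uncurry u) 3
      (volume.restrict (parabolicCylinder (Real.exp 1 * R) (0 : ℝ × EuclideanSpace ℝ (Fin 3)))))
      atTop (𝓝 0) := by
    have h := ENNReal.Tendsto.const_mul (hconv (Real.exp 1 * R) heR) (Or.inr hKtop) (a := K)
    rwa [mul_zero] at h
  have hlim := (hdil R hR).add (hBlim.add (hconv R hR))
  rw [add_zero, add_zero] at hlim
  have h0 : eLpNorm (Su - uncurry u) 3 μR = 0 := le_antisymm (ge_of_tendsto hlim hev) zero_le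
  rw [eLpNorm_eq_zero_iff (hSum.sub hUm) (by norm_num)] at h0
  filter_upwards [h0] with z hz
  rw [Pi.sub_apply, Pi.zero_apply, sub_eq_zero] at hz
  exact hz

/-- AUX-3 `stub_rotInvariantLimit` — **screw invariance with factors `c_j → 1` becomes rotation invariance in
the `L³_loc` limit**: if `V_j → u` in every `L³(Q(0,R))`, each `V_j` is a.e. fixed on the slab by the screw
`(c_j, θ)`, `c_j → 1`, and the dilations `D_{c_j} u → u` in every `L³(Q(0,R))`, then
`R_θ u(t, R_{−θ} x) = u(t, x)` a.e. on the slab (`rotInvariantLimit_ae_ball` on every ball, then exhaustion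
of the slab by the balls `Q(0, n+1)`). [folklore] -/
theorem stub_rotInvariantLimit :
    ∀ (θ : ℝ) (c : ℕ → ℝ) (V : ℕ → ℝ → EuclideanSpace ℝ (Fin 3) → EuclideanSpace ℝ (Fin 3)) (u : ℝ → EuclideanSpace ℝ (Fin 3) → EuclideanSpace ℝ (Fin 3)), (∀ j : ℕ, 0 < c j) → Filter.Tendsto c Filter.atTop (nhds 1) → (∀ (j : ℕ) (r : ℝ), 0 < r → ∀ R : ℝ, 0 < R → MeasureTheory.AEStronglyMeasurable (Function.uncurry (Literature.Analysis.FluidPDE.nsRescale r (V j))) (MeasureTheory.volume.restrict (Literature.Analysis.FluidPDE.parabolicCylinder R (0 : ℝ × EuclideanSpace ℝ (Fin 3))))) → (∀ (r : ℝ), 0 < r → ∀ R : ℝ, 0 < R → MeasureTheory.AEStronglyMeasurable (Function.uncurry (Literature.Analysis.FluidPDE.nsRescale r u)) (MeasureTheory.volume.restrict (Literature.Analysis.FluidPDE.parabolicCylinder R (0 : ℝ × EuclideanSpace ℝ (Fin 3))))) → (∀ R : ℝ, 0 < R → Filter.Tendsto (fun j : ℕ => MeasureTheory.eLpNorm (Function.uncurry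 (V j) - Function.uncurry u) 3 (MeasureTheory.volume.restrict (Literature.Analysis.FluidPDE.parabolicCylinder R (0 : ℝ × EuclideanSpace ℝ (Fin 3))))) Filter.atTop (nhds 0)) → (∀ R : ℝ, 0 < R → Filter.Tendsto (fun j : ℕ => MeasureTheory.eLpNorm (Function.uncurry (Literature.Analysis.FluidPDE.nsRescale (c j) u) - Function.uncurry u) 3 (MeasureTheory.volume.restrict (Literature.Analysis.FluidPDE.parabolicCylinder R (0 : ℝ × EuclideanSpace ℝ (Fin 3))))) Filter.atTop (nhds 0)) → (∀ j : ℕ, Function.uncurry (fun t x => Literature.Analysis.FluidPDE.rotZ θ (Literature.Analysis.FluidPDE.nsRescale (c j) (V j) t (Literature.Analysis.FluidPDE.rotZ (-θ) x))) =ᵐ[MeasureTheory.volume.restrict (Set.Iio (0 : ℝ) ×ˢ Set.univ)] Function.uncurry (V j)) → Function.uncurry (fun t x => Literature.Analysis.FluidPDE.rotZ θ (u t (Literature.Analysis.FluidPDE.rotZ (-θ) x))) =ᵐ[MeasureTheory.volume.restrict (Set.Iio (0 : ℝ) ×ˢ Set.univ)] Function.uncurry u := by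
  intro θ c V u hc0 hc1 hVm hum hconv hdil hfix
  -- exhaustion of the slab by the balls `Q(0, n+1)`
  refine ae_restrict_of_ae_restrict_of_subset
    Summit.NavierStokesRegularity.NavierStokesRegularity.Theorems.lowerHalf_subset_iUnion_parabolicCylinder ?_
  rw [ae_restrict_iUnion_iff]
  intro n
  exact rotInvariantLimit_ae_ball θ hc0 hc1 hVm hum hconv hdil hfix (R := (n : ℝ) + 1) (by positivity)

end Summit.NavierStokesRegularity.NavierStokesRegularity.Theorems.SymmetricScarExists.RdssSplit.NearIdentity

end
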